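import Summits.QuantumFields.YangMills.Theorems.BalabanUVNodesRateCarriersOfRecord12
import Summits.QuantumFields.YangMills.Theorems.BalabanUVNodesN22W1YoungLipschitz

/-!
# BalabanUVNodes ∕ node N22 = NE9 ∧ fading memory AT THE STAGE-12 RATE-RECORD HOME FOR A FIXED-CARRIER READING `U3Objects₁₁.ofFixed C EA EB ℓ`
# (node00-def-W1's `histCarriers ∕ functional` shape): `N22At` at the bundle IS NE9 of `EA` on `]0, θ.γ]` with the letter block's moduli — LEVEL-FREE;
# NE9 in ANY fading ∕ dominated modulus table suffices (`FadingMemory` BY NAME FROM A MODULUS); the W1 OBJECT's ROAD 1 (n22-c's history-Lipschitz estimate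
# (2.40)–(2.41) ⟹ NE9) READ AT THE HOME's BUNDLE and AT THE RECORD `S_N22 (RRec₁₂ 𝔯)` for a reading pinned to the W1 object

Track A of `YM-PLAN.md` (cell `pub-ymgap`, HUMAN RULING D-0062), R134 seat `pub-ymgap-dag-n22-e` (s2 «`FadingMemory` by name from a modulus + knit at the record»),
gen 2, module 3 — the lineage's g0 HANDOFF trigger (t2) «a NAMED W1 reading ⇒ `S_N22 (RRec 𝔯_W1)` one application» executed GENERICALLY at the repaired Stage 12: the named
reading itself is node00-def-W1 g2's (Literature side); this module supplies the Summits-side sockets it plugs into.  THEOREMS ONLY; imports layer B at ₁₂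
(`…RateCarriersOfRecord12`: `u3OfRecord₁₂`, `RRec₁₂`, `n22At_u3OfRecord₁₂_iff`, `s_N22_rRec₁₂_iff`) and n22-c's `…N22W1YoungLipschitz` (p458459:
`YMDAG.N22.W1.ne9_and_fadingMemory_functionalOn_of_youngLipschitz` — (2.40)–(2.41) on W1's `Node00/HistoryTermsOfRecord` object, p455641).  COUNT-NEUTRAL;
`--supports` the K3 item (stmt-QuantumFields-19676; K3′ at rev 10).  Restate-immune (no Theses import).

WHAT IS KERNEL-CHECKED ([folklore] bookkeeping; 0 `def`, 0 `sorry`).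
* §1 AT THE LEVEL-`k` BUNDLE of ANY U3 objects `u`: `ne9_of_moduli_le` (NE9 is monotone in the moduli), `n22At_u3OfRecord₁₂_of_ne9_le` (under the signs, NE9 of the level
  functional `u.EA k` on `]0, θ.γ]` with ANY table dominated by `u.C₉·u.ω^{n−i}` suffices), **`n22At_u3OfRecord₁₂_of_ne9_fading`** (**`FadingMemory` BY NAME FROM A MODULUS**:
  NE9 with a table `Λ` that FADES, `FadingMemory C₉ ω Λ` with `C₉ ≤ u.C₉`, `ω = u.ω`, suffices); the fixed-carrier reading `U3Objects₁₁.ofFixed C EA EB ℓ`: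
  `n22At_u3OfRecord₁₂_ofFixed_iff` (the run length `k` DROPS OUT: `N22At … ↔ NE9 EA (Window θ.γ) ℓ.κ ℓ.moduli`), `n22At_u3OfRecord₁₂_ofFixed_of_ne9_fading`.
* §2 AT THE RECORD, θ-form: `s_N22_rRec₁₂_of_ne9_fading` — signs + NE9 of every level functional in a fading table at every admissible tuple with provisos ⟹ `S_N22 (RRec₁₂ 𝔯)`.
* §3 THE W1 OBJECT AT THE BUNDLE: `n22At_u3OfRecord₁₂_w1_of_youngLipschitz` — for W1's cluster tower `S` on the torus catalogue `F.P K`, pairing `p`, backgrounds of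
  `p.BgA` read in `Φ` through `emb` inside the space tables, W1's `Bound238` + `YoungLipschitz` at every step on the boxes `box θ.γ k` with a FADING table `ℓtab`
  (`FadingMemory C₉ ω ℓtab`), n22-c's numerals (`0 < A`, `0 ≤ r₁`, `ℓ.κ ≤ r₁`, rate, doubled smallness) and the letter inequalities `ω = ℓ.ω`,
  `8·(e·9·64·K₀(64,8)²)·C₉ ≤ ℓ.C₉` ⟹ `N22At (u3OfRecord₁₂ θ (ofFixed (W1.histCarriers (F.P K) M p) (W1.functionalOn S p emb) EB ℓ) k)` at EVERY `k`;
  `n22At_u3OfRecord₁₂_w1Functional_of_youngLipschitz` — the same for THE FUNCTIONAL OF RECORD `W1.functional S ι p` (pairing with `BgA := GaugeField (F.P K) 0 G`);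
  `n22At_u3OfRecord₁₂_of_w1Level` — the same at the level-`k` bundle of ANY reading whose level-`k` bundle IS that W1 bundle (node00-def-W1 g2's per-run-length reading:
  level `k` on the `k`-th torus; the bundle equation is `rfl` there).
* §4 THE W1 OBJECT AT THE RECORD: `s_N22_rRec₁₂_of_w1` — a Stage-12 reading whose level bundles are the W1 object's for SOME W1 data per admissible tuple with provisos and
  run length, carrying §3's hypotheses there ⟹ `S_N22 (RRec₁₂ 𝔯)`.

HONEST FRAMING.  Every hypothesis is DISPLAYED and has NO producer at a named reading today: W1's `Bound238` ([II] Lemma 3 (2.38) — node N10's T-row) and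
`YoungLipschitz` (the differenced (2.38) with a fading table — NOT PRINTED; the adjudicated contraction `ω < 1`) are hypotheses; `𝔯`, `C`, `EA`, `S`, `p`, `emb`, `sp` are
PARAMETERS (node00-def-W1 g2 pins the named reading); nothing of Bałaban's is asserted or instantiated — NE9 is NOT PRINTED for d = 4 (OBJECT-bound; [Balaban1987RG1] p. 263:
C^∞ «(or analytic)» in the LAST coupling only) and NOT PROVED; no inhabitant of `IsDatumOfRecord₁₂C` claimed (K0′ open); N22 NOT discharged; counts UNMOVED (typed 28∕28 ·
discharged 5∕27, A 5∕28); one finite four-torus programme at fixed `ε` — NOT ℝ⁴, NOT infinite volume, NOT OS, NOT a mass gap, NOT Clay.  No decl below carries a cite tag.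
-/

noncomputable section

namespace YMDAG.N22

open Set Metric
open scoped BigOperators
open Literature.MathematicalPhysics.QuantumFieldTheory.Balaban1983to89
open Literature.MathematicalPhysics.QuantumFieldTheory.Balaban1983to89.T4Continuum
open Literature.MathematicalPhysics.QuantumFieldTheory.Balaban1983to89.T4OutputRate
open Literature.MathematicalPhysics.QuantumFieldTheory.Balaban1983to89.B12TreeDecay (K₀)
open Literature.MathematicalPhysics.QuantumFieldTheory.Balaban1983to89.Node00 (Stage12Params IsDatumOfRecord₁₂C U3Objects₁₁ U3Letters₁₁)
open Literature.MathematicalPhysics.QuantumFieldTheory.Balaban1983to89.Node00.Sect2 (domSys CPair ofBackgroundC)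
open Literature.MathematicalPhysics.QuantumFieldTheory.Balaban1983to89.Node00.W1 (RunPairing histCarriers ClusterTower functionalOn functional box)
open YMDAG.UVSplit

variable {N : ℕ} [NeZero N]

/-! ## §1 `N22At` at the level-`k` Stage-12 bundle from NE9 of the level functional in ANY fading ∕ dominated modulus table; the fixed-carrier reading -/

section Level

variable {F : T4Family} (θ : Stage12Params F N) (u : U3Objects₁₁) (k : ℕ)

/-- `NE9` is MONOTONE IN THE MODULI (only the entries `Λ n i`, `i < n`, are read; the tree's `Support/NE9BoundaryFamily.ne9_mono_moduli`, restated to keep this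
module's imports inside the Theorems ∕ Literature lanes). [folklore] -/
theorem ne9_of_moduli_le {C : Carriers} {Bg : Type} {E : Functional C Bg} {W : Set (ℕ → ℝ)} {κ : ℝ} {Λ Λ' : ℕ → ℕ → ℝ}
    (hΛ : ∀ n, ∀ i < n, Λ n i ≤ Λ' n i) (h : NE9 E W κ Λ) : NE9 E W κ Λ' := by
  intro g hg g' hg' U X
  refine (h g hg g' hg' U X).trans (mul_le_mul_of_nonneg_left (Finset.sum_le_sum fun i hi => ?_) (Real.exp_pos _).le)
  exact mul_le_mul_of_nonneg_right (hΛ _ i (Finset.mem_range.mp hi)) (abs_nonneg _)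

/-- **NE9 OF THE LEVEL FUNCTIONAL WITH ANY DOMINATED TABLE SUFFICES**: under the letter signs, `NE9 (u.EA k) (]0, θ.γ]) u.κ Λ` with `Λ n i ≤ u.C₉·u.ω^{n−i}` (`i < n`)
⟹ `N22At (u3OfRecord₁₂ θ u k)` (layer B's `n22At_u3OfRecord₁₂_iff` + monotonicity). [folklore] -/
theorem n22At_u3OfRecord₁₂_of_ne9_le (hs : u.Signs) {Λ : ℕ → ℕ → ℝ} (h9 : NE9 (u.EA k) (Window θ.γ) u.κ Λ)
    (hΛ : ∀ n, ∀ i < n, Λ n i ≤ u.C₉ * u.ω ^ (n - i)) : N22At (u3OfRecord₁₂ θ u k) :=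
  (n22At_u3OfRecord₁₂_iff θ u k hs).mpr (ne9_of_moduli_le (fun n i hi => (hΛ n i hi).trans_eq (u.moduli_eq n i).symm) h9)

/-- **`FadingMemory` BY NAME FROM A MODULUS**: under the letter signs, NE9 of the level functional `u.EA k` on `]0, θ.γ]` with decay `u.κ` in a table `Λ` that FADES —
`FadingMemory C₉ ω Λ` (`0 ≤ Λ n i ≤ C₉ ω^{n−i}`) with `C₉ ≤ u.C₉`, `ω = u.ω` — gives `N22At (u3OfRecord₁₂ θ u k)`: NE9 with the letter block's moduli AND the letter block's
fading memory (the latter is the block's shape, `fadingMemory_u3OfRecord₁₂`). [folklore] -/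
theorem n22At_u3OfRecord₁₂_of_ne9_fading (hs : u.Signs) {Λ : ℕ → ℕ → ℝ} {C₉ ω : ℝ} (h9 : NE9 (u.EA k) (Window θ.γ) u.κ Λ)
    (hfade : FadingMemory C₉ ω Λ) (hC₉ : C₉ ≤ u.C₉) (hω : ω = u.ω) : N22At (u3OfRecord₁₂ θ u k) := by
  refine n22At_u3OfRecord₁₂_of_ne9_le θ u k hs h9 fun n i hi => ((hfade n i hi.le).2).trans ?_
  rw [hω]
  exact mul_le_mul_of_nonneg_right hC₉ (pow_nonneg hs.ω_nonneg _)

end Level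

section Fixed

variable {F : T4Family} (θ : Stage12Params F N) (C : Carriers) (EA : Functional C C.BgA) (EB : ℝ → Functional C C.BgB) (ℓ : U3Letters₁₁) (k : ℕ)

/-- **AT A FIXED-CARRIER READING THE RUN LENGTH DROPS OUT**: under the letter signs, `N22At` at the level-`k` bundle of `U3Objects₁₁.ofFixed C EA EB ℓ` IS
`NE9 EA (]0, θ.γ]) ℓ.κ ℓ.moduli` — ONE history-Lipschitz statement about the ONE functional `EA`, for every `k` (layer B's `n22At_u3OfRecord₁₂_iff`, `rfl` faces of
`ofFixed`). [folklore] -/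
theorem n22At_u3OfRecord₁₂_ofFixed_iff (hs : ℓ.Signs) :
    N22At (u3OfRecord₁₂ θ (U3Objects₁₁.ofFixed C EA EB ℓ) k) ↔ NE9 EA (Window θ.γ) ℓ.κ ℓ.moduli :=
  n22At_u3OfRecord₁₂_iff θ _ k hs

/-- … so NE9 of `EA` in a fading table with `C₉ ≤ ℓ.C₉`, `ω = ℓ.ω` gives `N22At` at EVERY run length of the fixed-carrier bundle. [folklore] -/
theorem n22At_u3OfRecord₁₂_ofFixed_of_ne9_fading (hs : ℓ.Signs) {Λ : ℕ → ℕ → ℝ} {C₉ ω : ℝ} (h9 : NE9 EA (Window θ.γ) ℓ.κ Λ)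
    (hfade : FadingMemory C₉ ω Λ) (hC₉ : C₉ ≤ ℓ.C₉) (hω : ω = ℓ.ω) :
    N22At (u3OfRecord₁₂ θ (U3Objects₁₁.ofFixed C EA EB ℓ) k) :=
  n22At_u3OfRecord₁₂_of_ne9_fading θ _ k hs h9 hfade hC₉ hω

end Fixed

/-! ## §2 … and at the record: `S_N22 (RRec₁₂ 𝔯)` from NE9 of every level functional in a fading table (θ-form) -/

section Record

variable (𝔯 : RateReading₁₂ N)

/-- **`S_N22 (RRec₁₂ 𝔯)` FROM NE9 IN A FADING TABLE, θ-FORM** («`FadingMemory` by name from a modulus» at the record): if at every admissible Stage-12 tuple with provisos,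
every `(g₀, os)` and run length `k`, the reading's U3 objects carry their signs and the level functional `(𝔯.lit F θ hP g₀ os).u3.EA k` has NE9 on `]0, θ.γ]` with the block's
decay in SOME table fading at the block's rate `ω` with amplitude `≤` the block's `C₉`, then node N22's stub holds at the Stage-12 home. [folklore] -/
theorem s_N22_rRec₁₂_of_ne9_fading
    (h9 : ∀ (F : T4Family) (θ : Stage12Params F N) (hP : θ.Provisos₁₂ F N), θ.Admissible F N → ∀ (g₀ : ℕ → ℝ) (os : List (ULoop F)) (k : ℕ),
      (𝔯.lit F θ hP g₀ os).u3.Signs ∧ ∃ (Λ : ℕ → ℕ → ℝ) (C₉ : ℝ),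
        NE9 ((𝔯.lit F θ hP g₀ os).u3.EA k) (Window θ.γ) (𝔯.lit F θ hP g₀ os).u3.κ Λ ∧ FadingMemory C₉ (𝔯.lit F θ hP g₀ os).u3.ω Λ ∧
          C₉ ≤ (𝔯.lit F θ hP g₀ os).u3.C₉) :
    S_N22 (RRec₁₂ 𝔯) := by
  rw [s_N22_rRec₁₂_iff]
  intro F D h g₀ os k
  obtain ⟨hs, Λ, C₉, hne9, hfade, hC₉⟩ := h9 F h.params h.provisos h.admissible g₀ os k
  exact n22At_u3OfRecord₁₂_of_ne9_fading h.params _ k hs hne9 hfade hC₉ rfl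

end Record

/-! ## §3 THE W1 OBJECT at the Stage-12 bundle: ROAD 1 (n22-c's (2.40)–(2.41) ⟹ NE9) read at the home -/

section W1Object

variable (F : T4Family) (θ : Stage12Params F N) (K : ℕ) {𝔸 : Type*} {M : ℕ}

open Classical in
/-- **THE W1 HISTORY FUNCTIONAL CARRIES `N22At` AT EVERY RUN LENGTH OF ITS FIXED-CARRIER BUNDLE, ROAD 1.**  For W1's cluster tower `S` on the torus catalogue of `F.P K`
with cube side `M`, a pairing `p`, the run-A backgrounds `p.BgA` read in `Φ` through `emb` INSIDE the space tables `sp` (`emb U ∈ sp k Z`), run B's family `EB`, a letter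
block `ℓ` WITH ITS SIGNS, and at every step `k`: W1's `Bound238 (S k) (box θ.γ k) (sp k) A R` ([II] Lemma 3 (2.38), displayed) and `YoungLipschitz (S k) (box θ.γ k) (sp k)
(ℓtab (k+1) ·) R` (the differenced (2.38), displayed) with a FADING table `FadingMemory C₉ ω ℓtab`; n22-c's numerals `0 < A`, `0 ≤ r₁`, `ℓ.κ ≤ r₁`,
`r₁ + 2·(64·log 162) + 2 ≤ R`, `2A·e^{5r₁+1}·K₀(64,8)·9·64 ≤ 1`; and the letter inequalities `ω = ℓ.ω`, `8·(e·9·64·K₀(64,8)²)·C₉ ≤ ℓ.C₉`.  THEN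
`N22At (u3OfRecord₁₂ θ (ofFixed (W1.histCarriers (F.P K) M p) (W1.functionalOn S p emb) EB ℓ) k)` — n22-c's `ne9_and_fadingMemory_functionalOn_of_youngLipschitz` at
`γ := θ.γ`, `κ := ℓ.κ`, then §1. [folklore] -/
theorem n22At_u3OfRecord₁₂_w1_of_youngLipschitz (S : ClusterTower (F.P K) 𝔸 M) (p : RunPairing) (emb : p.BgA → CPair (F.P K) 𝔸)
    (EB : ℝ → Functional (histCarriers (F.P K) M p) (histCarriers (F.P K) M p).BgB) (ℓ : U3Letters₁₁) (k : ℕ)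
    (sp : (j : ℕ) → (domSys (F.P K) M (j + 1)).Dom → Set (CPair (F.P K) 𝔸)) (hsp : ∀ (j : ℕ) (U : p.BgA) Z, emb U ∈ sp j Z)
    {A R r₁ C₉ ω : ℝ} (ℓtab : ℕ → ℕ → ℝ) (hA : 0 < A) (hr₁ : 0 ≤ r₁) (hκ : ℓ.κ ≤ r₁) (hrate : r₁ + 2 * (64 * Real.log 162) + 2 ≤ R)
    (hsmall : 2 * A * Real.exp (5 * r₁ + 1) * K₀ 64 8 * 9 * 64 ≤ 1) (hfade : FadingMemory C₉ ω ℓtab)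
    (h238 : ∀ j, (S j).Bound238 (box θ.γ j) (sp j) A R)
    (hYL : ∀ j, (S j).YoungLipschitz (box θ.γ j) (sp j) (fun i : Fin (j + 1) => ℓtab (j + 1) i) R)
    (hs : ℓ.Signs) (hω : ω = ℓ.ω) (hC₉ : 8 * (Real.exp 1 * 9 * 64 * K₀ 64 8 ^ 2) * C₉ ≤ ℓ.C₉) :
    N22At (u3OfRecord₁₂ θ (U3Objects₁₁.ofFixed (histCarriers (F.P K) M p) (functionalOn S p emb) EB ℓ) k) := by
  obtain ⟨h9, hfm⟩ := YMDAG.N22.W1.ne9_and_fadingMemory_functionalOn_of_youngLipschitz F K S p emb sp hsp ℓtab hA hr₁ hκ hrate hsmall hfade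
    h238 hYL
  exact n22At_u3OfRecord₁₂_ofFixed_of_ne9_fading θ _ _ EB ℓ k hs h9 hfm hC₉ hω

open Classical in
/-- **… FOR THE FUNCTIONAL OF RECORD `W1.functional S ι p`** (the real `G`-valued gauge field read through `ι : G →* 𝔸ˣ`; the pairing's run-A backgrounds ARE the gauge
fields: `p := ⟨GaugeField (F.P K) 0 G, BgB, gauge, _, transport⟩`). [folklore] -/
theorem n22At_u3OfRecord₁₂_w1Functional_of_youngLipschitz [Ring 𝔸] (S : ClusterTower (F.P K) 𝔸 M) {G : Type} [Group G] (ι : G →* 𝔸ˣ)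
    (BgB : Type) (gauge : GaugeField (F.P K) 0 G → GaugeField (F.P K) 0 G → ℝ) (hgauge : ∀ U U', 0 ≤ gauge U U')
    (transport : BgB → GaugeField (F.P K) 0 G)
    (EB : ℝ → Functional (histCarriers (F.P K) M ⟨GaugeField (F.P K) 0 G, BgB, gauge, hgauge, transport⟩)
      (histCarriers (F.P K) M ⟨GaugeField (F.P K) 0 G, BgB, gauge, hgauge, transport⟩).BgB)
    (ℓ : U3Letters₁₁) (k : ℕ)
    (sp : (j : ℕ) → (domSys (F.P K) M (j + 1)).Dom → Set (CPair (F.P K) 𝔸)) (hsp : ∀ (j : ℕ) (U : GaugeField (F.P K) 0 G) Z, ofBackgroundC ι U ∈ sp j Z)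
    {A R r₁ C₉ ω : ℝ} (ℓtab : ℕ → ℕ → ℝ) (hA : 0 < A) (hr₁ : 0 ≤ r₁) (hκ : ℓ.κ ≤ r₁) (hrate : r₁ + 2 * (64 * Real.log 162) + 2 ≤ R)
    (hsmall : 2 * A * Real.exp (5 * r₁ + 1) * K₀ 64 8 * 9 * 64 ≤ 1) (hfade : FadingMemory C₉ ω ℓtab)
    (h238 : ∀ j, (S j).Bound238 (box θ.γ j) (sp j) A R)
    (hYL : ∀ j, (S j).YoungLipschitz (box θ.γ j) (sp j) (fun i : Fin (j + 1) => ℓtab (j + 1) i) R)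
    (hs : ℓ.Signs) (hω : ω = ℓ.ω) (hC₉ : 8 * (Real.exp 1 * 9 * 64 * K₀ 64 8 ^ 2) * C₉ ≤ ℓ.C₉) :
    N22At (u3OfRecord₁₂ θ (U3Objects₁₁.ofFixed (histCarriers (F.P K) M ⟨GaugeField (F.P K) 0 G, BgB, gauge, hgauge, transport⟩)
      (functional S ι ⟨GaugeField (F.P K) 0 G, BgB, gauge, hgauge, transport⟩) EB ℓ) k) :=
  n22At_u3OfRecord₁₂_w1_of_youngLipschitz F θ K S ⟨GaugeField (F.P K) 0 G, BgB, gauge, hgauge, transport⟩ (ofBackgroundC ι) EB ℓ k sp hsp ℓtab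
    hA hr₁ hκ hrate hsmall hfade h238 hYL hs hω hC₉

open Classical in
/-- **… AT THE LEVEL-`k` BUNDLE OF ANY READING WHOSE LEVEL-`k` DATA ARE THE W1 OBJECT** (node00-def-W1 g2's PER-RUN-LENGTH reading: level `k` lives on the `k`-th torus,
`u.levelCarriers k = W1.histCarriers (F.P K) M p`, `u.EA k = W1.functionalOn S p emb` — recorded as ONE equation of bundles, which holds by `rfl` for such a reading):
`u3OfRecord₁₂ θ u k = u3OfRecord₁₂ θ (ofFixed (W1.histCarriers (F.P K) M p) (W1.functionalOn S p emb) EB ℓ) k` + §3's hypotheses ⟹ `N22At (u3OfRecord₁₂ θ u k)`.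
[folklore] -/
theorem n22At_u3OfRecord₁₂_of_w1Level (u : U3Objects₁₁) (k : ℕ) (S : ClusterTower (F.P K) 𝔸 M) (p : RunPairing)
    (emb : p.BgA → CPair (F.P K) 𝔸) (EB : ℝ → Functional (histCarriers (F.P K) M p) (histCarriers (F.P K) M p).BgB) (ℓ : U3Letters₁₁)
    (hu : u3OfRecord₁₂ θ u k = u3OfRecord₁₂ θ (U3Objects₁₁.ofFixed (histCarriers (F.P K) M p) (functionalOn S p emb) EB ℓ) k)
    (sp : (j : ℕ) → (domSys (F.P K) M (j + 1)).Dom → Set (CPair (F.P K) 𝔸)) (hsp : ∀ (j : ℕ) (U : p.BgA) Z, emb U ∈ sp j Z)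
    {A R r₁ C₉ ω : ℝ} (ℓtab : ℕ → ℕ → ℝ) (hA : 0 < A) (hr₁ : 0 ≤ r₁) (hκ : ℓ.κ ≤ r₁) (hrate : r₁ + 2 * (64 * Real.log 162) + 2 ≤ R)
    (hsmall : 2 * A * Real.exp (5 * r₁ + 1) * K₀ 64 8 * 9 * 64 ≤ 1) (hfade : FadingMemory C₉ ω ℓtab)
    (h238 : ∀ j, (S j).Bound238 (box θ.γ j) (sp j) A R)
    (hYL : ∀ j, (S j).YoungLipschitz (box θ.γ j) (sp j) (fun i : Fin (j + 1) => ℓtab (j + 1) i) R)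
    (hs : ℓ.Signs) (hω : ω = ℓ.ω) (hC₉ : 8 * (Real.exp 1 * 9 * 64 * K₀ 64 8 ^ 2) * C₉ ≤ ℓ.C₉) :
    N22At (u3OfRecord₁₂ θ u k) := by
  rw [hu]
  exact n22At_u3OfRecord₁₂_w1_of_youngLipschitz F θ K S p emb EB ℓ k sp hsp ℓtab hA hr₁ hκ hrate hsmall hfade h238 hYL hs hω hC₉

end W1Object

/-! ## §4 THE W1 OBJECT at the record: `S_N22 (RRec₁₂ 𝔯)` for a reading whose bundles are the W1 object's, ROAD 1 -/

section W1Record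

variable (𝔯 : RateReading₁₂ N) {𝔸 : Type*}

open Classical in
/-- **`S_N22 (RRec₁₂ 𝔯)` FOR A STAGE-12 READING WHOSE LEVEL BUNDLES ARE THE W1 OBJECT's, ROAD 1.**  If at every admissible Stage-12 tuple with provisos, every `(g₀, os)` AND
EVERY RUN LENGTH `k`, the reading's level-`k` bundle IS the level-`k` bundle of `ofFixed (W1.histCarriers (F.P K) M p) (W1.functionalOn S p emb) EB ℓ` for SOME W1 data
(torus `K` — node00-def-W1 g2 takes the `k`-th one —, cube side `M`, cluster tower `S`, pairing `p`, reading map `emb`, family `EB`, letter block `ℓ`; `rfl` for W1's reading)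
carrying §3's displayed hypotheses (space tables, `Bound238`, `YoungLipschitz` with a fading table on the boxes of `θ.γ`, n22-c's numerals, the letter signs and
inequalities), then node N22's stub holds at the Stage-12 home — where node00-def-W1's NAMED reading and n22-c's estimate MEET. [folklore] -/
theorem s_N22_rRec₁₂_of_w1
    (hw1 : ∀ (F : T4Family) (θ : Stage12Params F N) (hP : θ.Provisos₁₂ F N), θ.Admissible F N → ∀ (g₀ : ℕ → ℝ) (os : List (ULoop F)) (k : ℕ),
      ∃ (K M : ℕ) (S : ClusterTower (F.P K) 𝔸 M) (p : RunPairing) (emb : p.BgA → CPair (F.P K) 𝔸)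
        (EB : ℝ → Functional (histCarriers (F.P K) M p) (histCarriers (F.P K) M p).BgB) (ℓ : U3Letters₁₁)
        (sp : (j : ℕ) → (domSys (F.P K) M (j + 1)).Dom → Set (CPair (F.P K) 𝔸)) (A R r₁ C₉ ω : ℝ) (ℓtab : ℕ → ℕ → ℝ),
        u3OfRecord₁₂ θ (𝔯.lit F θ hP g₀ os).u3 k = u3OfRecord₁₂ θ (U3Objects₁₁.ofFixed (histCarriers (F.P K) M p) (functionalOn S p emb) EB ℓ) k ∧
        (∀ (j : ℕ) (U : p.BgA) Z, emb U ∈ sp j Z) ∧ 0 < A ∧ 0 ≤ r₁ ∧ ℓ.κ ≤ r₁ ∧ r₁ + 2 * (64 * Real.log 162) + 2 ≤ R ∧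
        2 * A * Real.exp (5 * r₁ + 1) * K₀ 64 8 * 9 * 64 ≤ 1 ∧ FadingMemory C₉ ω ℓtab ∧
        (∀ j, (S j).Bound238 (box θ.γ j) (sp j) A R) ∧ (∀ j, (S j).YoungLipschitz (box θ.γ j) (sp j) (fun i : Fin (j + 1) => ℓtab (j + 1) i) R) ∧
        ℓ.Signs ∧ ω = ℓ.ω ∧ 8 * (Real.exp 1 * 9 * 64 * K₀ 64 8 ^ 2) * C₉ ≤ ℓ.C₉) :
    S_N22 (RRec₁₂ 𝔯) := by
  rw [s_N22_rRec₁₂_iff]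
  intro F D h g₀ os k
  obtain ⟨K, M, S, p, emb, EB, ℓ, sp, A, R, r₁, C₉, ω, ℓtab, hu, hsp, hA, hr₁, hκ, hrate, hsmall, hfade, h238, hYL, hs, hω, hC₉⟩ :=
    hw1 F h.params h.provisos h.admissible g₀ os k
  exact n22At_u3OfRecord₁₂_of_w1Level F h.params K _ k S p emb EB ℓ hu sp hsp ℓtab hA hr₁ hκ hrate hsmall hfade h238 hYL hs hω hC₉

end W1Record

end YMDAG.N22

end
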